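import Summits.NavierStokesRegularity.NavierStokesRegularity.Theorems.FrequencyRigidity.Negative.TwoEndedPinningStubs

/-!
# `FrequencyRigidity` (crux `stmt-NavierStokesRegularity-2955`), line `two-ended-pinning`, Stub 3
# (`stub_flatEnstrophyLiouville`): the pinned enstrophy law is realised by honest Navier–Stokes
# dynamics — the exact linear strain–rotation flow — negative-side support (refuter, drefute g2)

Companion of `Negative/TwoEndedPinningStubs.lean` (its verbatim copies of the line's vocabulary
`ScaleInvariantBounds`, `firstVariationDensity`, `IsFlatInhabitant` are reused; there the one-clause
mutations (vii), (viii) are inhabited by the ZERO flow).  Here a two-clause mutation is inhabited by a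
flow with non-zero vorticity and genuine vortex stretching:
* `linFlow c t x = M(t)x`, `M(t) = (2t)⁻¹ diag(1,1,−2) − (c t⁻¹)(e₃ × ·)` (planar inflow at the parabolic
  rate `1/(2t)`, axial stretching `1/(−t)`, rotation `c/(−t)`), with the quadratic pressure
  `linPressure c t x = (1+4c²)‖x‖²/(8t²) − (9+4c²)x₃²/(8t²)`, is a CLASSICAL Navier–Stokes flow on
  `ℝ³ × (−∞,0)` for every viscosity (`isClassicalNSSolutionOn_linFlow`; `Ṁ + M²` is symmetric exactly
  because `ġ = −2fg` for `g = c/(−t)`, `f = 1/(2t)` — Majda–Bertozzi §1.4, exact linear flows).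
* `curl v(t) ≡ (2c/(−t))e₃` (`curl_linFlow`), so against the backward heat kernel — indeed any unit-mass
  weight (`adaptedEnstrophy_linFlow_of_unit_mass`) — `H(t) = 4c²(−t)^{−2}` EXACTLY (clause (viii),
  `Λ ≡ 2`: `adaptedEnstrophy_linFlow_flat`); the scale-invariant bounds (iv) hold
  (`scaleInvariantBounds_linFlow`); and the transport-free first variation (ix) holds on the nose
  (`firstVariation_linFlow`: `2(⟪ω,Mω⟫ − ν|∇ω|²_F) = 8c²(−t)^{−3} = H′` — vortex stretching at the axial
  rate `1/(−t)` produces exactly the self-similar enstrophy growth).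
* `stub_flatEnstrophyLiouville_false_without_typeI_adjoint`: `IsFlatInhabitant` with (iii) (GLOBAL
  Type-I) dropped and the adjoint equation removed from the kernel clauses (v) is INHABITED; the
  witness violates exactly those two (`linFlow_not_hasTypeITimeDecay`: linear growth;
  `linFlow_adjoint_fails`: the heat kernel is not adapted — on paper no positive unit-mass kernel
  with finite planar second moment `m` is, since the pairing rule gives `m′ = m/t − 4ν < 0`-driven
  `m(τ) = τ(k + 4ν log τ) < 0` for small `τ = −t`).
Moral for Stub 3 / the crux: pinning (`Λ₀ = 2`, `t²H ≡ A`, landed (T)) and even the instantaneous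
budget `𝒮 − ν𝒫 = A(−t)^{−3}`, WITH the NS dynamics and the scale-invariant bounds, carry no
contradiction; a proof must use the spatial localisation — the sup bound (iii) and/or the kernel's
adaptedness/concentration (length scale `√(−t)`) — i.e. the bounded-profile (R)SS regime.
No `¬`-theorem of a Theses decl is claimed; nothing here asserts a route statement positively.

## References

* A. J. Majda, A. L. Bertozzi, *Vorticity and Incompressible Flow*, CUP (2002), §1.4 (exact
  solutions with linear velocity `v = M(t)x`). [MajdaBertozziCUP2002]
* T.-P. Tsai, Arch. Ration. Mech. Anal. 143 (1998) 29–51, Thm 1. [Tsai1998]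
-/

noncomputable section

set_option linter.dupNamespace false

namespace Summit.NavierStokesRegularity.NavierStokesRegularity.Theorems.FrequencyRigidity.Negative.TwoEndedPinning

open Literature.Analysis.FluidPDE Literature.Analysis.UnboundedOperators
open MeasureTheory Set Filter Topology Function
open scoped Laplacian InnerProductSpace RealInnerProductSpace ContDiff

/-! ### The axial strain `Dax = diag(1,1,−2)` and the gradient matrix of the flow -/
/-- `Dax x = x − 3 x₃ e₃ = (x₁, x₂, −2x₃)`: trace-free axisymmetric strain (planar part `+1`,
axial part `−2`). -/
def Dax : E3 →L[ℝ] E3 := ContinuousLinearMap.id ℝ E3 - (3:ℝ) • (innerSL ℝ e₃).smulRight e₃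
/-- Coordinates of `e₃ = (0,0,1)`. -/
@[simp] theorem e₃_apply_zero : e₃ 0 = 0 := by simp [e₃]
/-- Coordinates of `e₃ = (0,0,1)`. -/
@[simp] theorem e₃_apply_one : e₃ 1 = 0 := by simp [e₃]
/-- Coordinates of `e₃ = (0,0,1)`. -/
@[simp] theorem e₃_apply_two : e₃ 2 = 1 := by simp [e₃]
/-- `⟪e₃, x⟫ = x₃`. -/
theorem inner_e₃_left (x : E3) : ⟪e₃, x⟫ = x 2 := by
  rw [e₃, EuclideanSpace.inner_single_left]; simp
/-- `Dax x = x − 3x₃e₃`. -/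
theorem Dax_apply (x : E3) : Dax x = x - (3 * x 2) • e₃ := by
  simp only [Dax, FunLike.coe_sub, Pi.sub_apply, ContinuousLinearMap.id_apply,
    FunLike.coe_smul, Pi.smul_apply, ContinuousLinearMap.smulRight_apply,
    innerSL_apply_apply, inner_e₃_left, smul_smul]
/-- Coordinates of `Dax x = (x₁, x₂, −2x₃)`. -/
@[simp] theorem Dax_apply_zero (x : E3) : Dax x 0 = x 0 := by simp [Dax_apply]
/-- Coordinates of `Dax x = (x₁, x₂, −2x₃)`. -/
@[simp] theorem Dax_apply_one (x : E3) : Dax x 1 = x 1 := by simp [Dax_apply]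
/-- Coordinates of `Dax x = (x₁, x₂, −2x₃)`. -/
@[simp] theorem Dax_apply_two (x : E3) : Dax x 2 = -2 * x 2 := by simp [Dax_apply]; ring
/-- The velocity-gradient matrix `M(t) = (2t)⁻¹ Dax − (c t⁻¹) rot` of the flow
(planar inflow at the parabolic rate `1/(2t) < 0`, axial stretching `−1/t > 0`, rotation rate
`c/(−t)`). -/
def Mlin (c t : ℝ) : E3 →L[ℝ] E3 := (2 * t)⁻¹ • Dax - (c * t⁻¹) • rot
/-- Unfolding `Mlin`. -/
theorem Mlin_apply (c t : ℝ) (x : E3) : Mlin c t x = (2 * t)⁻¹ • Dax x - (c * t⁻¹) • rot x := rfl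
/-- Coordinates of `M(t)x`. -/
@[simp] theorem Mlin_apply_zero (c t : ℝ) (x : E3) :
    Mlin c t x 0 = (2 * t)⁻¹ * x 0 + c * t⁻¹ * x 1 := by simp [Mlin_apply]
/-- Coordinates of `M(t)x`. -/
@[simp] theorem Mlin_apply_one (c t : ℝ) (x : E3) :
    Mlin c t x 1 = (2 * t)⁻¹ * x 1 - c * t⁻¹ * x 0 := by simp [Mlin_apply]
/-- Coordinates of `M(t)x`. -/
@[simp] theorem Mlin_apply_two (c t : ℝ) (x : E3) : Mlin c t x 2 = -(t⁻¹ * x 2) := by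
  simp [Mlin_apply]; ring
/-- **The linear strain–rotation flow** `v(t, x) = M(t) x`. -/
def linFlow (c : ℝ) (t : ℝ) (x : E3) : E3 := Mlin c t x
/-- Its pressure `q(t, x) = (1 + 4c²)‖x‖²/(8t²) − (9 + 4c²) x₃²/(8t²)` (`= −½ xᵀ(Ṁ + M²)x`). -/
def linPressure (c : ℝ) (t : ℝ) (x : E3) : ℝ :=
  (1 + 4 * c ^ 2) / (8 * t ^ 2) * ‖x‖ ^ 2 - (9 + 4 * c ^ 2) / (8 * t ^ 2) * ⟪e₃, x⟫ ^ 2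
/-- The time slices of the flow are the linear maps `M(t)`. -/
theorem linFlow_eq (c t : ℝ) : linFlow c t = ⇑(Mlin c t) := rfl

/-! ### Calculus of the flow -/
/-- `∂ₜv(t, x) = Ṁ(t)x`. -/
theorem hasDerivAt_linFlow (c : ℝ) {t : ℝ} (ht : t ≠ 0) (x : E3) :
    HasDerivAt (fun s => linFlow c s x)
      ((-(2 * 1) / (2 * t) ^ 2) • Dax x - (c * -(t ^ 2)⁻¹) • rot x) t := by
  have h1 : HasDerivAt (fun s : ℝ => (2 * s)⁻¹) (-(2 * 1) / (2 * t) ^ 2) t :=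
    ((hasDerivAt_id t).const_mul 2).inv (by simpa using ht)
  have h2 : HasDerivAt (fun s : ℝ => c * s⁻¹) (c * -(t ^ 2)⁻¹) t :=
    (hasDerivAt_inv ht).const_mul c
  exact (h1.smul_const (Dax x)).sub (h2.smul_const (rot x))
/-- `∂ₜv` within the open time set `(−∞,0)` is the honest derivative `Ṁ(t)x`. -/
theorem timeDerivWithin_linFlow (c : ℝ) {t : ℝ} (ht : t < 0) (x : E3) :
    timeDerivWithin (Iio 0) (linFlow c) t x =
      (-(2 * 1) / (2 * t) ^ 2) • Dax x - (c * -(t ^ 2)⁻¹) • rot x := by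
  rw [timeDerivWithin_apply, derivWithin_of_mem_nhds (Iio_mem_nhds ht)]
  exact (hasDerivAt_linFlow c ht.ne x).deriv
/-- `(v·∇)v = M(Mx)`. -/
theorem convect_linFlow (c t : ℝ) (x : E3) :
    convect (linFlow c t) (linFlow c t) x = Mlin c t (Mlin c t x) := by
  rw [convect_apply, linFlow_eq, ContinuousLinearMap.fderiv]
/-- `Δv = 0` (linear field). -/
theorem laplacian_linFlow (c t : ℝ) (x : E3) : (Δ (linFlow c t)) x = 0 := by
  rw [linFlow_eq]; exact laplacian_clm _ x
/-- Derivative of the quadratic pressure. -/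
theorem hasFDerivAt_linPressure (c t : ℝ) (x : E3) :
    HasFDerivAt (linPressure c t)
      (((1 + 4 * c ^ 2) / (8 * t ^ 2)) • (2 • innerSL ℝ x) -
        ((9 + 4 * c ^ 2) / (8 * t ^ 2)) • ((2 • ⟪e₃, x⟫ ^ (2 - 1)) • innerSL ℝ e₃)) x := by
  have h1 : HasFDerivAt (fun y : E3 => ‖y‖ ^ 2) (2 • innerSL ℝ x) x :=
    (hasStrictFDerivAt_norm_sq x).hasFDerivAt
  have h2 : HasFDerivAt (fun y : E3 => ⟪e₃, y⟫) (innerSL ℝ e₃) x := (innerSL ℝ e₃).hasFDerivAt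
  have h3 : HasFDerivAt (fun y : E3 => ⟪e₃, y⟫ ^ 2) ((2 • ⟪e₃, x⟫ ^ (2 - 1)) • innerSL ℝ e₃) x :=
    h2.pow 2
  exact (h1.const_mul _).sub (h3.const_mul _)
/-- `∇q(t,x) = (1+4c²)x/(4t²) − (9+4c²)x₃e₃/(4t²)`. -/
theorem gradient_linPressure (c t : ℝ) (x : E3) :
    gradient (linPressure c t) x =
      (2 * ((1 + 4 * c ^ 2) / (8 * t ^ 2))) • x - (2 * ((9 + 4 * c ^ 2) / (8 * t ^ 2)) * x 2) • e₃ := by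
  have hP : HasFDerivAt (linPressure c t)
      (InnerProductSpace.toDual ℝ E3
        ((2 * ((1 + 4 * c ^ 2) / (8 * t ^ 2))) • x - (2 * ((9 + 4 * c ^ 2) / (8 * t ^ 2)) * x 2) • e₃)) x := by
    refine (hasFDerivAt_linPressure c t x).congr_fderiv (ContinuousLinearMap.ext fun h => ?_)
    simp only [two_smul, FunLike.coe_sub, FunLike.coe_add, FunLike.coe_smul, Pi.sub_apply,
      Pi.add_apply, Pi.smul_apply, innerSL_apply_apply, InnerProductSpace.toDual_apply_apply,
      inner_sub_left, inner_smul_left, inner_e₃_left, smul_eq_mul,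
      conj_trivial, pow_one, Nat.add_one_sub_one]
    ring
  exact (hasGradientAt_iff_hasFDerivAt.mpr hP).gradient
/-- The momentum identity `Ṁx + M(Mx) = −∇q`, coordinatewise. -/
theorem linFlow_momentum (c : ℝ) {t : ℝ} (ht : t < 0) (x : E3) :
    timeDerivWithin (Iio 0) (linFlow c) t x + convect (linFlow c t) (linFlow c t) x =
      -gradient (linPressure c t) x := by
  rw [timeDerivWithin_linFlow c ht, convect_linFlow, gradient_linPressure]
  have ht0 : t ≠ 0 := ht.ne
  ext i
  fin_cases i <;>
    (simp [Mlin_apply_zero, Mlin_apply_one, Mlin_apply_two] ; field_simp ; ring)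
/-- `div v = tr M(t) = 0`. -/
theorem divergence_linFlow (c t : ℝ) (x : E3) : VectorCalculus.divergence (linFlow c t) x = 0 := by
  rw [divergence_eq_sum_inner_fderiv (EuclideanSpace.basisFun (Fin 3) ℝ), linFlow_eq,
    ContinuousLinearMap.fderiv, Fin.sum_univ_three]
  simp only [EuclideanSpace.basisFun_apply, EuclideanSpace.inner_single_left, map_one, one_mul,
    Mlin_apply_zero, Mlin_apply_one, Mlin_apply_two]
  simp
  ring

/-! ### Joint smoothness; the flow is a classical Navier–Stokes solution on `(−∞,0)` -/
/-- The velocity is jointly smooth on `(−∞,0) × ℝ³`. -/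
theorem isSmoothSpaceTimeOn_linFlow (c : ℝ) : IsSmoothSpaceTimeOn (Iio 0) (linFlow c) := by
  have hne : ∀ p ∈ Iio (0:ℝ) ×ˢ (univ : Set E3), p.1 ≠ 0 := fun p hp => (show p.1 < 0 from hp.1).ne
  have h1 : ContDiffOn ℝ ∞ (fun p : ℝ × E3 => (2 * p.1)⁻¹) (Iio 0 ×ˢ univ) :=
    (contDiffOn_const.mul contDiffOn_fst).inv fun p hp => mul_ne_zero two_ne_zero (hne p hp)
  have h2 : ContDiffOn ℝ ∞ (fun p : ℝ × E3 => c * p.1⁻¹) (Iio 0 ×ˢ univ) :=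
    contDiffOn_const.mul (contDiffOn_fst.inv hne)
  have h3 : ContDiffOn ℝ ∞ (fun p : ℝ × E3 => Dax p.2) (Iio 0 ×ˢ univ) :=
    (Dax.contDiff.comp contDiff_snd).contDiffOn
  have h4 : ContDiffOn ℝ ∞ (fun p : ℝ × E3 => rot p.2) (Iio 0 ×ˢ univ) :=
    (rot.contDiff.comp contDiff_snd).contDiffOn
  exact (h1.smul h3).sub (h2.smul h4)
/-- The pressure is jointly smooth on `(−∞,0) × ℝ³`. -/
theorem isSmoothSpaceTimeOn_linPressure (c : ℝ) : IsSmoothSpaceTimeOn (Iio 0) (linPressure c) := by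
  have hne : ∀ p ∈ Iio (0:ℝ) ×ˢ (univ : Set E3), 8 * p.1 ^ 2 ≠ 0 := fun p hp => by
    have : p.1 ≠ 0 := (show p.1 < 0 from hp.1).ne
    positivity
  have h1 : ContDiffOn ℝ ∞ (fun p : ℝ × E3 => (1 + 4 * c ^ 2) / (8 * p.1 ^ 2)) (Iio 0 ×ˢ univ) :=
    contDiffOn_const.div (contDiffOn_const.mul (contDiffOn_fst.pow 2)) hne
  have h2 : ContDiffOn ℝ ∞ (fun p : ℝ × E3 => (9 + 4 * c ^ 2) / (8 * p.1 ^ 2)) (Iio 0 ×ˢ univ) :=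
    contDiffOn_const.div (contDiffOn_const.mul (contDiffOn_fst.pow 2)) hne
  have h3 : ContDiffOn ℝ ∞ (fun p : ℝ × E3 => ‖p.2‖ ^ 2) (Iio 0 ×ˢ univ) :=
    ((contDiff_norm_sq ℝ).comp contDiff_snd).contDiffOn
  have h4 : ContDiffOn ℝ ∞ (fun p : ℝ × E3 => ⟪e₃, p.2⟫ ^ 2) (Iio 0 ×ˢ univ) :=
    ((contDiff_const.inner ℝ contDiff_snd).pow 2).contDiffOn
  exact (h1.mul h3).sub (h2.mul h4)
/-- **The linear strain–rotation flow is a classical Navier–Stokes flow on `ℝ³ × (−∞,0)` for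
every viscosity** (`Δv = 0`; `Ṁ + M²` is symmetric exactly because the rotation rate `c/(−t)`
obeys `ġ = −2fg` under the planar inflow `f = 1/(2t)`). -/
theorem isClassicalNSSolutionOn_linFlow (c ν : ℝ) :
    IsClassicalNSSolutionOn (Iio 0) ν 0 (linFlow c) (linPressure c) where
  smooth_velocity := isSmoothSpaceTimeOn_linFlow c
  smooth_pressure := isSmoothSpaceTimeOn_linPressure c
  momentum t ht x := by
    rw [linFlow_momentum c ht x, laplacian_linFlow]
    simp
  divFree t _ := fun x => divergence_linFlow c t x

/-! ### Vorticity, adapted enstrophy, scale-invariant bounds, first variation -/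
/-- The vorticity is spatially constant: `curl v(t) = (2c/(−t)) e₃`. -/
theorem curl_linFlow (c t : ℝ) (x : E3) : curl (linFlow c t) x = (-(2 * c * t⁻¹)) • e₃ := by
  rw [linFlow_eq]
  simp only [curl, ContinuousLinearMap.fderiv]
  ext i
  fin_cases i <;> (simp [e₃]; try ring)
/-- `‖curl v(t)‖² ≡ 4c²/t²`. -/
theorem norm_curl_linFlow_sq (c t : ℝ) (x : E3) : ‖curl (linFlow c t) x‖ ^ 2 = 4 * c ^ 2 * (t ^ 2)⁻¹ := by
  rw [curl_linFlow, norm_smul, e₃, PiLp.norm_single, Real.norm_eq_abs, norm_one, mul_one, sq_abs]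
  ring

/-- `H(t) = 4c²/t²` against the backward heat kernel (any unit-mass kernel would do). -/
theorem adaptedEnstrophy_linFlow {ν : ℝ} (hν : 0 < ν) (c : ℝ) {t : ℝ} (ht : t < 0) :
    adaptedEnstrophy (linFlow c) (backwardHeatKernel ν 0 (0:E3)) t = 4 * c ^ 2 * (t ^ 2)⁻¹ := by
  rw [adaptedEnstrophy_apply]
  simp_rw [norm_curl_linFlow_sq]
  rw [integral_const_mul, integral_backwardHeatKernel hν (0:E3) ht, mul_one]

/-- The enstrophy law is kernel-independent: `H(t) = 4c²/t²` against ANY unit-mass weight. -/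
theorem adaptedEnstrophy_linFlow_of_unit_mass (c : ℝ) {K : ℝ → E3 → ℝ} {t : ℝ}
    (hK : ∫ x, K t x = 1) : adaptedEnstrophy (linFlow c) K t = 4 * c ^ 2 * (t ^ 2)⁻¹ := by
  rw [adaptedEnstrophy_apply]
  simp_rw [norm_curl_linFlow_sq]
  rw [integral_const_mul, hK, mul_one]

/-- The flat law (viii): `H(t) = 4c² (−t)^{−2}`. -/
theorem adaptedEnstrophy_linFlow_flat {ν : ℝ} (hν : 0 < ν) (c : ℝ) {t : ℝ} (ht : t < 0) :
    adaptedEnstrophy (linFlow c) (backwardHeatKernel ν 0 (0:E3)) t = 4 * c ^ 2 * (-t) ^ (-(2:ℝ)) := by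
  rw [adaptedEnstrophy_linFlow hν c ht, Real.rpow_neg (by linarith), Real.rpow_two, neg_sq]

/-- Constants of the scale-invariant bounds: only `k = 1` is non-zero. -/
def linC (c : ℝ) : ℕ → ℝ := fun k => if k = 1 then ‖Dax‖ / 2 + |c| * ‖rot‖ else 0

/-- `‖M(t)‖ ≤ (‖Dax‖/2 + |c|‖rot‖)(−t)⁻¹` for `t < 0`. -/
theorem norm_Mlin_le (c : ℝ) {t : ℝ} (ht : t < 0) :
    ‖Mlin c t‖ ≤ (‖Dax‖ / 2 + |c| * ‖rot‖) * (-t)⁻¹ := by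
  have ht' : 0 < -t := by linarith
  have h1 : ‖(2 * t)⁻¹ • Dax‖ = ‖Dax‖ / 2 * (-t)⁻¹ := by
    rw [norm_smul, norm_inv, Real.norm_eq_abs, abs_mul, abs_of_neg ht, abs_two]
    field_simp
  have h2 : ‖(c * t⁻¹) • rot‖ = |c| * ‖rot‖ * (-t)⁻¹ := by
    rw [norm_smul, Real.norm_eq_abs, abs_mul, abs_inv, abs_of_neg ht]
    ring
  calc ‖Mlin c t‖ ≤ ‖(2 * t)⁻¹ • Dax‖ + ‖(c * t⁻¹) • rot‖ := norm_sub_le _ _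
    _ = (‖Dax‖ / 2 + |c| * ‖rot‖) * (-t)⁻¹ := by rw [h1, h2]; ring

/-- `Dv(t) ≡ M(t)`. -/
theorem fderiv_linFlow (c t : ℝ) : fderiv ℝ (linFlow c t) = fun _ => Mlin c t := by
  funext y; rw [linFlow_eq, ContinuousLinearMap.fderiv]

/-- Clause (iv): the scale-invariant derivative bounds (`‖Dv(t)‖ = O((−t)^{−1})`, `Dᵏv = 0`
for `k ≥ 2`). -/
theorem scaleInvariantBounds_linFlow (c : ℝ) : ScaleInvariantBounds (linC c) (linFlow c) := by
  intro k hk t ht x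
  rcases Nat.eq_or_lt_of_le hk with h1 | h2
  · subst h1
    have he : (-(((1:ℕ) : ℝ) + 1) / 2 : ℝ) = -1 := by norm_num
    rw [he, Real.rpow_neg_one, norm_iteratedFDeriv_one, fderiv_linFlow]
    simp only [linC, if_true]
    exact norm_Mlin_le c ht
  · obtain ⟨m, rfl⟩ : ∃ m, k = m + 2 := ⟨k - 2, by omega⟩
    have h0 : ‖iteratedFDeriv ℝ (m + 2) (linFlow c t) x‖ = 0 := by
      rw [← norm_iteratedFDeriv_fderiv, fderiv_linFlow, iteratedFDeriv_succ_const, Pi.zero_apply,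
        norm_zero]
    have hC : linC c (m + 2) = 0 := by simp [linC]
    rw [h0, hC, zero_mul]

/-- The axial strain rate: `⟪e₃, M(t)e₃⟫ = −t⁻¹ = 1/(−t)`. -/
theorem inner_e₃_Mlin_e₃ (c t : ℝ) : ⟪e₃, Mlin c t e₃⟫ = -t⁻¹ := by
  rw [inner_e₃_left, Mlin_apply_two, e₃_apply_two, mul_one]

/-- The transport-free first-variation density is spatially constant:
`2(⟪ω, Mω⟫ − ν·0) = −8c²/t³ = 8c²(−t)^{−3}` (vortex stretching at the axial rate `1/(−t)`). -/
theorem firstVariationDensity_linFlow (ν c t : ℝ) (x : E3) :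
    firstVariationDensity ν (linFlow c) t x = -(8 * c ^ 2 * t⁻¹ ^ 3) := by
  have hc : curl (linFlow c t) = fun _ => (-(2 * c * t⁻¹)) • e₃ := funext (curl_linFlow c t)
  have hf : fderiv ℝ (fun _ : E3 => (-(2 * c * t⁻¹)) • e₃) x = 0 := by simp
  have hfr : frobeniusNormSq (0 : E3 →L[ℝ] E3) = 0 := by simp [frobeniusNormSq]
  rw [firstVariationDensity, hc, hf, fderiv_linFlow, hfr]
  simp only [mul_zero, sub_zero, map_smul, inner_smul_left, inner_smul_right, conj_trivial,
    inner_e₃_Mlin_e₃]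
  ring

/-- Clause (ix): `H′(t) = ∫ (first-variation density) K(t)`. -/
theorem firstVariation_linFlow {ν : ℝ} (hν : 0 < ν) (c : ℝ) {t : ℝ} (ht : t < 0) :
    HasDerivAt (adaptedEnstrophy (linFlow c) (backwardHeatKernel ν 0 (0:E3)))
      (∫ x, firstVariationDensity ν (linFlow c) t x * backwardHeatKernel ν 0 (0:E3) t x) t := by
  have hint : (∫ x, firstVariationDensity ν (linFlow c) t x * backwardHeatKernel ν 0 (0:E3) t x) =
      -(8 * c ^ 2 * t⁻¹ ^ 3) := by
    simp_rw [firstVariationDensity_linFlow]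
    rw [integral_const_mul, integral_backwardHeatKernel hν (0:E3) ht, mul_one]
  have hH : adaptedEnstrophy (linFlow c) (backwardHeatKernel ν 0 (0:E3)) =ᶠ[𝓝 t]
      fun s => 4 * c ^ 2 * (s ^ 2)⁻¹ := by
    filter_upwards [Iio_mem_nhds ht] with s hs
    exact adaptedEnstrophy_linFlow hν c hs
  have hd : HasDerivAt (fun s : ℝ => 4 * c ^ 2 * (s ^ 2)⁻¹)
      (4 * c ^ 2 * (-(↑(2:ℕ) * t ^ (2 - 1)) / (t ^ 2) ^ 2)) t :=
    ((hasDerivAt_pow 2 t).inv (pow_ne_zero 2 ht.ne)).const_mul _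
  rw [hint]
  refine (hd.congr_of_eventuallyEq hH).congr_deriv ?_
  have ht0 : t ≠ 0 := ht.ne
  field_simp
  ring

/-! ### The mutation of Stub 3: drop (iii) Type-I, and the adjoint equation from (v) -/

/-- `IsFlatInhabitant` with clause (iii) (the global Type-I bound) DROPPED and the adjoint
equation (clause (v.3), `∂ₜK + DK·v + νΔK = 0`) removed from the kernel clauses — everything else
((i), (ii) classical NS, (iv) scale-invariant bounds, (v.1,2,4,5), (vi) Gaussian comparability,
(vii) `0 < A`, (viii) the EXACT flat enstrophy law, (ix) the transport-free first variation)
verbatim. -/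
def IsFlatInhabitantWithoutTypeIAdjoint (ν A : ℝ) (C' : ℕ → ℝ) (v : ℝ → E3 → E3) (q : ℝ → E3 → ℝ)
    (K : ℝ → E3 → ℝ) : Prop :=
  0 < ν ∧ IsClassicalNSSolutionOn (Iio 0) ν 0 v q ∧ ScaleInvariantBounds C' v ∧
    (ContDiffOn ℝ 2 (uncurry K) (Iio (0:ℝ) ×ˢ univ) ∧ (∀ t ∈ Iio (0:ℝ), ∀ x, 0 < K t x) ∧
      (∀ t ∈ Iio (0:ℝ), ∫ x, K t x = 1) ∧
      (∀ φ : E3 → ℝ, Continuous φ → (∃ M : ℝ, ∀ x, |φ x| ≤ M) →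
        Tendsto (fun t => ∫ x, φ x * K t x) (𝓝[<] 0) (𝓝 (φ 0)))) ∧
    IsGaussianComparable K (Iio 0) 0 0 ∧ 0 < A ∧
    (∀ t < 0, adaptedEnstrophy v K t = A * (-t) ^ (-(2 : ℝ))) ∧
    (∀ t < 0, HasDerivAt (adaptedEnstrophy v K) (∫ x, firstVariationDensity ν v t x * K t x) t)

/-- **The linear strain–rotation flow inhabits the mutation** (with `A = 4c²`, `c ≠ 0`, the
backward heat kernel and any `ν > 0`). -/
theorem isFlatInhabitantWithoutTypeIAdjoint_linFlow {ν c : ℝ} (hν : 0 < ν) (hc : c ≠ 0) :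
    IsFlatInhabitantWithoutTypeIAdjoint ν (4 * c ^ 2) (linC c) (linFlow c) (linPressure c)
      (backwardHeatKernel ν 0 (0:E3)) := by
  have hK := isAdaptedBackwardKernel_backwardHeatKernel (E := E3) hν 0 0
  refine ⟨hν, isClassicalNSSolutionOn_linFlow c ν, scaleInvariantBounds_linFlow c,
    ⟨hK.contDiffOn, hK.pos, hK.integral_eq_one, hK.tendsto_integral_mul⟩,
    isGaussianComparable_backwardHeatKernel hν 0 0, by positivity,
    fun t ht => adaptedEnstrophy_linFlow_flat hν c ht, fun t ht => firstVariation_linFlow hν c ht⟩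

/-- **Stub 3 is FALSE without {(iii), (v.3)}**: the enstrophy clauses (vii)–(ix) — pinning
`Λ₀ = 2`, the exact flat law `t²H ≡ A`, and the instantaneous budget `𝒮 − ν𝒫 = A(−t)^{−3}` — are
realised by honest Navier–Stokes dynamics (vortex stretching at the critical strain rate)
together with the scale-invariant bounds (iv).  Any proof of `stub_flatEnstrophyLiouville`
must use the spatial localisation: the global sup bound (iii) and/or the adaptedness of the
kernel to the flow (v.3). -/
theorem stub_flatEnstrophyLiouville_false_without_typeI_adjoint :
    ¬ ∀ (ν A : ℝ) (C' : ℕ → ℝ) (v : ℝ → E3 → E3) (q : ℝ → E3 → ℝ) (K : ℝ → E3 → ℝ),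
      ¬ IsFlatInhabitantWithoutTypeIAdjoint ν A C' v q K :=
  fun h => h 1 (4 * 1 ^ 2) (linC 1) (linFlow 1) (linPressure 1) (backwardHeatKernel 1 0 (0:E3))
    (isFlatInhabitantWithoutTypeIAdjoint_linFlow one_pos one_ne_zero)

/-! ### Which dropped clauses the witness violates -/

/-- At `t = −1`, `M e₃ = e₃`. -/
theorem Mlin_neg_one_e₃ (c : ℝ) : Mlin c (-1) e₃ = e₃ := by
  ext i
  fin_cases i <;> simp

/-- The flow violates the global Type-I bound (iii) (linear growth in `x`): at `t = −1`,
`v(−1, s e₃) = s e₃`. -/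
theorem linFlow_not_hasTypeITimeDecay (c C : ℝ) : ¬ HasTypeITimeDecay C (linFlow c) := by
  intro h
  have h1 := h (-1) (by norm_num) ((|C| + 1) • e₃)
  rw [linFlow, map_smul, Mlin_neg_one_e₃, norm_smul, e₃, PiLp.norm_single, norm_one, mul_one,
    Real.norm_eq_abs, neg_neg, Real.sqrt_one, div_one] at h1
  have h2 : C ≤ |C| := le_abs_self C
  have h3 : (0:ℝ) ≤ |C| + 1 := by positivity
  rw [abs_of_nonneg h3] at h1
  linarith

/-- The backward heat kernel is NOT adapted to the flow: the adjoint equation (v.3) fails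
(`DK·v ≠ 0` since the flow is not tangent to the spheres about the pole; on paper no positive
unit-mass kernel with finite planar second moment solves it on any `(−ε,0)`:
`m′ = m/t − 4ν` forces `m < 0` near `t = 0`). -/
theorem linFlow_adjoint_fails {ν : ℝ} (hν : 0 < ν) (c : ℝ) :
    ¬ ∀ t ∈ Iio (0:ℝ), ∀ x : E3,
      timeDerivWithin (Iio 0) (backwardHeatKernel ν 0 (0:E3)) t x +
        fderiv ℝ (backwardHeatKernel ν 0 (0:E3) t) x (linFlow c t x) +
        ν * (Δ (backwardHeatKernel ν 0 (0:E3) t)) x = 0 := by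
  intro h
  have hK := isAdaptedBackwardKernel_backwardHeatKernel (E := E3) hν 0 0
  have ht : (-1:ℝ) ∈ Iio (0:ℝ) := by norm_num
  have h0 := hK.adjoint_eq (-1) ht e₃
  simp only [Pi.zero_apply, map_zero, add_zero] at h0
  have h1 := h (-1) ht e₃
  have h2 : fderiv ℝ (backwardHeatKernel ν 0 (0:E3) (-1)) e₃ (linFlow c (-1) e₃) = 0 := by
    linarith
  rw [fderiv_backwardHeatKernel_apply, linFlow, inner_e₃_Mlin_e₃] at h2
  have hpos : 0 < heatKernel (ν * (0 - (-1))) e₃ := heatKernel_pos (by simpa using hν) _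
  have hν2 : (2 * (ν * (0 - (-1:ℝ)))) ≠ 0 := by
    have : (0:ℝ) - (-1) = 1 := by norm_num
    rw [this, mul_one]; positivity
  have hB : (-(-1 : ℝ)⁻¹) = 1 := by norm_num
  rw [hB, mul_one, neg_eq_zero, div_eq_zero_iff] at h2
  rcases h2 with h2 | h2
  · exact hpos.ne' h2
  · exact hν2 h2

end Summit.NavierStokesRegularity.NavierStokesRegularity.Theorems.FrequencyRigidity.Negative.TwoEndedPinning

end
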